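import Summits.BirchSwinnertonDyer.BirchSwinnertonDyer.Theorems.ByReductionTypeAtTwoMultSlopePinch
import Summits.BirchSwinnertonDyer.Rank1Residual.X5.TwoAdicInstancesINT412830t
import HarnessLib

/-!
# Route `ByReductionTypeAtTwo`, child `MultLowerHalfAtTwo` (item stmt-BirchSwinnertonDyer-19923): `BSD₂` — hence the
# item's instance `MissingLowerBoundAt W 2` — AT the fourth «K = 4» singleton class **412830t** (`N = 2·3³·5·11·139`,
# `a₂ = −1`, `E[2]` irreducible, `ρ_{E,2^∞}` onto, `Δ < 0`, `λ_an = 12`, `#Ш_an = 2⁸`), by the SLOPE-PINCH door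

HONEST FRAMING (cell `bsd-2adic`, run/shared/lean/pub/bsd-2adic/, seat `bsd-2adic-mult-3` GEN 9, HUMAN RULINGS
D-0036 / D-0054 / D-0074 row (A)): research route; THEOREMS ONLY (the curve is the `abbrev` of the mult lane's instance
file `X5/TwoAdicInstancesINT412830t.lean`, whose decidable data — `Mult c 2`, non-split, `Δ < 0`, `ρ_{E,2^∞}` surjective
modulo the named fact `hDD` — are reused BY NAME); nothing asserted, nothing booked; BSD is not proved by any of this.
PARTITION (D-0054): X5@2 mult, the ONE door-level residue class of item 19923 (mult-3 GEN 2 census + GEN 6/8: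
`MultK4Classes` covers 172042o / 219558q / 349522b by the Kato-INT `λ`-pinch with a layer count `n = λ_an ≤ 4`; for
412830t `λ_an = 12` needs the layer-`4` count over `ℚ(ζ₆₄)⁺` — kit j262312, degree-48 descent algebra, NOT reached — and
`2⁸ ∣ #Ш` needs Cassels–Tate at level `16`, no engine) × p = 2 — types-the-object-of PER CLASS (the 4th of 4); closes none
by itself (class theorems modulo the displayed MEMO + certificates); nothing booked.

THE ROAD: `MultSlopePinch.bsdp_two_nonsplit_of_katoInt_slopePinch_display` (this seat GEN 9) — the Kato-INT pinch with the
`λ`-LOWER input `λ(X) ≥ λ_an` REPLACED by `λ(X) ≥ 3` + the `2`-adic valuations of the first three coefficients of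
`ϖ·L₂(E)` (pure algebra `SlopePinch.isUnit_of_slopePinch`: Newton slopes `9/2, 9/2, 1/10 × 10` admit no proper factor
of even constant valuation). Displayed inputs: PRINT {Dokchitser–Dokchitser `hDD`, guarded Thm-4.1 analogue `h41`,
`hmod`, `hGZK`, Prop. 4.14@2 `h414`, Česnavičius `hC`}; MEMO {T-KATO2-NSMULT `hKint` (HOME/mult/PROOF-KATO2MULT.md Thm. A) —
the SAME memo binder as the three `MultK4Classes` rows and as `Instances.missingUpperBoundAt_two_412830t1`}; CERTIFICATES
{`μ_an = 0` (`hμan`, two-engine: eng-2 TABLE-MULT-E2 + ENGINE-1 j250807); `hcoef` = the coefficient valuations of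
`ϖ·L₂(E)`: `v₂(c₀) = 10` (= `v₂(2·L(E,1)/Ω_E)`, `x₀ = 512`, C0 identity EXACT, both engines), `2⁶ ∣ c₁`, `v₂(c₂) = 1`
(eng-2 afe2 v2 j248630 `percurve/2696-412830t1.out`: level `n = 6` reads `c₁ = −78464 = −2⁷·613`, `c₂ = −2·842233`;
`[Tⁱ]L ≡ cᵢ (mod 2^{n−⌊log₂ i⌋})` since `L ≡ L_n (mod ω_n)`; levels `4, 5, 6` read `v₂(c₁) = 4, 5, 7` (increasing = lower
bounds) and `v₂(c₂) = 1, 1, 1`; ENGINE-1 agrees at its level (`c₁ = 12144 ≡ 0 mod 2⁴`, `c₂ = 56886`); the bit `2⁶ ∣ c₁`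
is engine-2-only until kit j271305 (ENGINE-1 at conductor `2⁸`, this seat) reports}; the layer count
`2⁴ ≤ #Sel_{2^∞}(E/ℚ_2)[2]` (`hsel`: `d₂ = 4` over `ℚ(ζ₁₆)⁺`, TWO-ENGINE A j254833 + B j255888, lower count GRH-free) and
`2² ≤ #Sel_{2^∞}(E/ℚ)[2]` (`hsel₀`: `d₀ = 2`, PARI `ellrank` + ENGINE A/B)}; `r_an = 0` (`hr`, Cremona). NO `λ_an`
certificate, no layer-`4` count, no level-`16` descent.

References: R. Greenberg, LNM 1716 (1999), §4 pp. 112–113, Prop. 4.14 (p. 124); K. Kato, Astérisque 295 (2004),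
17.11–17.13; T. and V. Dokchitser, Math. Z. 272 (2012), Theorem (p. 961); K. Česnavičius, Compos. Math. 154 (2018),
Thm. 1.2; L. Washington, *Introduction to Cyclotomic Fields*, §7.1; R. L. Miller, LMS J. Comput. Math. 14 (2011),
Def. 1.1; J. Cremona, *Algorithms for Modular Elliptic Curves* (1997), Table 1.
-/

set_option autoImplicit false
set_option linter.dupNamespace false

noncomputable section

open scoped Classical MatrixGroups ModularForm

open CongruenceSubgroup WeierstrassCurve Literature.NumberTheory.EllipticCurves
  Literature.NumberTheory.EllipticCurves.ModularForms
  Literature.NumberTheory.EllipticCurves.Greenberg1999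
  Literature.NumberTheory.EllipticCurves.Rank1Residual
  Literature.NumberTheory.EllipticCurves.Rank1Residual.Typed Summit.BirchSwinnertonDyer.Rank1Residual
  Summit.BirchSwinnertonDyer.Rank1Residual.X5 Summit.BirchSwinnertonDyer.Rank1Residual.X5.O1
  Summit.BirchSwinnertonDyer.Rank1Residual.X5.Instances
  Summit.BirchSwinnertonDyer.BirchSwinnertonDyer.Theorems.MultSlopePinch

namespace Summit.BirchSwinnertonDyer.BirchSwinnertonDyer.Theorems.MultK4

/-! ## 412830t (N = 2·3³·5·11·139, a₂ = −1, `λ_an = 12`, `#Ш_an = 2⁸`): slope pinch with `(s, t) = (10, 6)` -/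

/-- **`BSD₂(412830t1)` by the SLOPE pinch** — PRINT {`hDD`, `h41`, `hmod`, `hGZK`, `h414`, `hC`} + MEMO {T-KATO2-NSMULT
`hKint`} + CERT {`μ_an = 0`; `v₂(c₀) = 10`, `2⁶ ∣ c₁`, `v₂(c₂) = 1` for `ϖ·L₂(E)` (`hcoef`); `2⁴ ≤ #Sel_{2^∞}(E/ℚ_2)[2]`
(`hsel`, `ℚ_2 = ℚ(ζ₁₆)⁺`); `2² ≤ #Sel_{2^∞}(E/ℚ)[2]` (`hsel₀`)} + `r_an = 0`; the numerics `Even 10`, `10 + 2 ≤ 2·6`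
decided here. [cite: GreenbergLNM1716, §4 pp. 112–113 and Prop. 4.14 (p. 124)] [cite: DokchitserDokchitserMathZ2012, Theorem (p. 961)]
[cite: Cesnavicius2018, Thm. 1.2] [cite: Washington1997, §7.1] [cite: Miller2011LMS, Def. 1.1 and §1] -/
theorem bsdp_two_412830t1_slope (hDD : DokchitserDokchitser2012_surjective_mod_two_four_eight)
    (h41 : thm41Analogue_charValue_rankZero_numberField_anyPrime_oddLocalDegree)
    (hmod : nonempty_modularParametrizationData) (hGZK : rank_eq_analyticRank_of_analyticRank_le_one)
    (h414 : prop414_noFiniteSubmodule_of_not_dvd_torsionOrder)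
    (hC : cesnavicius_not_two_dvd_maninConstant_of_two_dvd_level)
    (hKint : KatoDivisibilityAtTwoNonsplitMultInt c412830t1) (hr : c412830t1.analyticRank = 0)
    (hμan : X2.AnalyticMuLE c412830t1 2 0)
    (hcoef : ∀ {N : ℕ} [NeZero N] (f : CuspForm (Gamma0 N) 2), IsNewformOf c412830t1 f →
      ∀ (ϖ : ℚ), (ϖ : ℝ) * c412830t1.realPeriodRat = plusPeriod f →
      ∀ (L : PowerSeries ℚ_[2]), IsMultPAdicLFunctionOf f 2 (-1) L →
      ∀ (G : IwasawaAlgebra 2), iwasawaToPowerSeries 2 G = PowerSeries.C (ϖ : ℚ_[2]) * L →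
        (PowerSeries.coeff 0 G).valuation = 10 ∧ (2 : ℤ_[2]) ^ 6 ∣ PowerSeries.coeff 1 G ∧
          PowerSeries.coeff 2 G ≠ 0 ∧ (PowerSeries.coeff 2 G).valuation = 1)
    (hsel : ∀ κ : ZpExtension ℚ 2, κ.IsCyclotomic →
      2 ^ 4 ≤ Nat.card {z : c412830t1.selmerLayer κ 2 // 2 • z = 0})
    (hsel₀ : 2 ^ 2 ≤ Nat.card {z : c412830t1.selmerGroupPInfty 2 // 2 • z = 0}) : BSDp c412830t1 2 :=
  bsdp_two_nonsplit_of_katoInt_slopePinch_display c412830t1 h41 hmod hGZK h414 hC hKint hr mult_two_412830t1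
    not_split_two_412830t1 (surj_two_412830t1 hDD) delta_neg_412830t1 hμan hcoef (by decide) (by norm_num)
    (fun κ hκ => le_trans (by norm_num) (hsel κ hκ)) (le_trans (by norm_num) hsel₀)

/-- **Item 19923 AT 412830t1: `Typed.MissingLowerBoundAt c412830t1 2` (`ord₂ #Ш_an ≤ ord₂ #Ш`, i.e. `2⁸ ∣ #Ш(E/ℚ)` given
`#Ш_an = 2⁸`)** — same inputs. With `MultK4Classes` (172042o, 219558q, 349522b) the four «K = 4» singletons of the item's
door-level census all carry a kernel `BSD₂` class theorem modulo the SAME memo binder T-KATO2-NSMULT + PRINT + certificates.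
[cite: Miller2011LMS, Def. 1.1 (arXiv:1010.2431 p. 3)] [cite: GreenbergLNM1716, Prop. 4.14 (p. 124)] -/
theorem missingLowerBoundAt_two_412830t1_slope (hDD : DokchitserDokchitser2012_surjective_mod_two_four_eight)
    (h41 : thm41Analogue_charValue_rankZero_numberField_anyPrime_oddLocalDegree)
    (hmod : nonempty_modularParametrizationData) (hGZK : rank_eq_analyticRank_of_analyticRank_le_one)
    (h414 : prop414_noFiniteSubmodule_of_not_dvd_torsionOrder)
    (hC : cesnavicius_not_two_dvd_maninConstant_of_two_dvd_level)
    (hKint : KatoDivisibilityAtTwoNonsplitMultInt c412830t1) (hr : c412830t1.analyticRank = 0)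
    (hμan : X2.AnalyticMuLE c412830t1 2 0)
    (hcoef : ∀ {N : ℕ} [NeZero N] (f : CuspForm (Gamma0 N) 2), IsNewformOf c412830t1 f →
      ∀ (ϖ : ℚ), (ϖ : ℝ) * c412830t1.realPeriodRat = plusPeriod f →
      ∀ (L : PowerSeries ℚ_[2]), IsMultPAdicLFunctionOf f 2 (-1) L →
      ∀ (G : IwasawaAlgebra 2), iwasawaToPowerSeries 2 G = PowerSeries.C (ϖ : ℚ_[2]) * L →
        (PowerSeries.coeff 0 G).valuation = 10 ∧ (2 : ℤ_[2]) ^ 6 ∣ PowerSeries.coeff 1 G ∧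
          PowerSeries.coeff 2 G ≠ 0 ∧ (PowerSeries.coeff 2 G).valuation = 1)
    (hsel : ∀ κ : ZpExtension ℚ 2, κ.IsCyclotomic →
      2 ^ 4 ≤ Nat.card {z : c412830t1.selmerLayer κ 2 // 2 • z = 0})
    (hsel₀ : 2 ^ 2 ≤ Nat.card {z : c412830t1.selmerGroupPInfty 2 // 2 • z = 0}) :
    MissingLowerBoundAt c412830t1 2 :=
  missingLowerBoundAt_two_nonsplit_of_katoInt_slopePinch_display c412830t1 h41 hmod hGZK h414 hC hKint hr
    mult_two_412830t1 not_split_two_412830t1 (surj_two_412830t1 hDD) delta_neg_412830t1 hμan hcoef (by decide)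
    (by norm_num) (fun κ hκ => le_trans (by norm_num) (hsel κ hκ)) (le_trans (by norm_num) hsel₀)

end Summit.BirchSwinnertonDyer.BirchSwinnertonDyer.Theorems.MultK4

end
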